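/-
Copyright (c) 2026 the pub-hodgecm-mathlib formalisation cell (harness21).  Prover seat hodgecm-mathlib-K2Liu-p23 (g2), Track B «K2-LIT»,
#184♮ = hLiu418 = `stmt-HodgeConjecture-24832`; #42F′ FACE-G organ F4 (G-gen), road (E) (RULING M-158r), brick (E-a1) «THE MULTILINEAR FIRST FUNDAMENTAL
THEOREM: `End_{GL(V)}(V^{⊗d})` is spanned by the permutations of the factors» (LEAD F0P6-plan (g14) BATCH #113 (2)(a); F4 lead K2Liu-p27 (g2)).
KERNEL: theorems only.
-/
import Literature.NumberTheory.DiophantineGeometry.SchurWeylPlethysmIrreducibleProofs   -- ★ Maschke for `k[𝔖_d]` on `(k^σ)^{⊗d}`, ★ `mem_span_glTensorRep_of_comm` (FH Lemma 6.23), `permTensorRep`, `glTensorRep`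
import HarnessLib

/-!
# Crux `HLiu418`, FACE-G organ F4, road (E), brick (E-a1): THE MULTILINEAR FIRST FUNDAMENTAL THEOREM FOR `GL(V)` —
# an endomorphism of `V^{⊗d}` commuting with every `g^{⊗d}`, `g ∈ GL(V)`, is a linear combination of the permutations of the factors

Cell `hodgecm-mathlib`, crux item hLiu418 = `stmt-HodgeConjecture-24832`, route of record `HCCMUnconditional`; squad K2 ∕ K2Liu, road `K2_Liu`,
socket #42F′, FACE-G organ F4 (G-gen) under RULING M-158r «(E) COMPACT SEE-SAW + FFT + PBW INDUCTION + `K_H`-AVERAGING» (K2E5-r02 (g6)); F4 lead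
K2Liu-p27 (g2), desk K2Liu-p10 (g6).  THEOREMS ONLY (no `def`, no `instance`, no `notation`, no named-fact hypothesis, no `sorry`); lane
`--supports stmt-HodgeConjecture-24832 --as helper` (count-neutral helper).

WHY.  STEP 1 of road (E) is the first fundamental theorem of invariant theory for `GL_p`: the `U(p)`-invariant polynomials on `M_{2×p} ⊕ M̄_{2×p}` of
bidegree `(d, d)` are polynomials in the four contractions `Σ_a x_{ia} ȳ_{ja}` ([Weyl1939] II.A; [FultonHarrisGTM129] §6.2 and App. F).  Its MULTILINEAR
form — the one every proof polarises down to — is Schur's double-commutant statement for the commuting actions of `𝔖_d` (`permTensorRep`, permuting the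
factors) and `GL(V)` (`glTensorRep`, diagonal) on `V^{⊗d}`, `V = k^σ`:

* **`mem_span_permTensorRep_of_comm_glTensorRep`** — over a field `k` of characteristic `0`, an endomorphism `φ` of `(k^σ)^{⊗d}` commuting with every
  `g^{⊗d}`, `g ∈ GL σ k`, lies in the `k`-span of the operators `τ ↦ permTensorRep τ`, `τ ∈ 𝔖_d` — i.e. `End_{GL(V)}(V^{⊗d}) = k[𝔖_d]`-image
  [cite: FultonHarrisGTM129, Thm. 6.3 (2) with Lemma 6.22 (i)–(ii), Lemma 6.23].  PROOF (the printed double-centralizer mechanism, all inputs ★ or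
  Mathlib): (1) by ★ `mem_span_glTensorRep_of_comm` (FH Lemma 6.23: the `𝔖_d`-commutant is spanned by the `g^{⊗d}`) `φ` commutes with EVERY
  `𝔖_d`-equivariant endomorphism (`comp_eq_comp_of_comm_permTensorRep`); (2) transported to the `k[𝔖_d]`-module `M = ρ.asModule` of
  `ρ = permTensorRep`, `φ` is therefore linear over the commutant `End_{k[𝔖_d]}(M)`; (3) `M` is a semisimple `k[𝔖_d]`-module (Maschke, Mathlib instance,
  `char k = 0`), so by the JACOBSON DENSITY THEOREM (Mathlib `jacobson_density`) `φ` agrees with the action of some `r ∈ k[𝔖_d]` on the finite basis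
  `tensorBasis` of `V^{⊗d}`, hence everywhere (`Basis.ext`); (4) `ρ(r) = Σ_τ r(τ) · permTensorRep τ` lies in the span.
* **`mem_span_permTensorRep_iff_comm_glTensorRep`** — the `iff` (the converse is ★ `permTensorRep_comp_glTensorRep`, FH §6.1).

This is brick (E-a1) of the census K2Liu-p23 (g2) 2026-09-04T22:59:50Z; bricks (E-a2) (polarisation ∕ restitution of bidegree-`(d,d)` polynomials,
`char 0`) and (E-a3) (the contraction statement on `M_{2×p} ⊕ M_{2×p}`) consume it.  Degenerate instances: `d = 0` (`V^{⊗0} = k`, `𝔖_0 = 1`, every `φ`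
is a scalar = a multiple of `permTensorRep 1` ✓), `σ = ∅` with `d > 0` (`V^{⊗d} = 0`, `φ = 0` ✓) — both covered by the statement as written.
References: [FultonHarrisGTM129] §6.1–§6.2 (Thm. 6.3, Lemmas 6.22–6.23); [Weyl1939] Ch. III–IV (the classical statement); [GoodmanWallachGTM255]
§4.2.4 (Schur–Weyl duality), §5.3 (tensor FFT).
HONEST LABEL.  Count-neutral helper; it retires nothing by itself: `HC_CM` is proved only modulo the 7 printed citations (2 remaining named inputs:
hLiu418 = `stmt-HodgeConjecture-24832`, h413 = `stmt-HodgeConjecture-24833`) until rung 0 closes.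

## References
* [FultonHarrisGTM129] W. Fulton, J. Harris, *Representation Theory. A First Course*, GTM 129, Springer (1991), §6.1–§6.2, Thm. 6.3, Lemmas 6.22, 6.23.
* [GoodmanWallachGTM255] R. Goodman, N. R. Wallach, *Symmetry, Representations, and Invariants*, GTM 255 (2009), §4.2.4, §5.3.
-/

set_option autoImplicit false
set_option linter.dupNamespace false -- the mandated namespace repeats `HodgeConjecture.HodgeConjecture`

noncomputable section

open scoped BigOperators TensorProduct
open Literature.NumberTheory.DiophantineGeometry

namespace Summit.HodgeConjecture.HodgeConjecture.Cruxes.HLiu418.K2LiuTensorPowerDoubleCommutant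

variable {k : Type*} [Field k] {σ : Type*} [Fintype σ] [DecidableEq σ] {d : ℕ}

/-- **an endomorphism commuting with every `g^{⊗d}` commutes with every `𝔖_d`-equivariant endomorphism** (over an infinite field): the `𝔖_d`-commutant
is spanned by the `g^{⊗d}` (★ `mem_span_glTensorRep_of_comm`, FH Lemma 6.23), and commuting with a spanning set is commuting with the span.
[cite: FultonHarrisGTM129, Lemma 6.23] -/
theorem comp_eq_comp_of_comm_permTensorRep [Infinite k] (φ : Module.End k (TensorPower k d (σ → k)))
    (hφ : ∀ g : GL σ k, φ ∘ₗ glTensorRep σ k d g = glTensorRep σ k d g ∘ₗ φ)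
    (ψ : Module.End k (TensorPower k d (σ → k)))
    (hψ : ∀ τ : Equiv.Perm (Fin d), ψ ∘ₗ permTensorRep k (σ → k) d τ = permTensorRep k (σ → k) d τ ∘ₗ ψ) :
    φ ∘ₗ ψ = ψ ∘ₗ φ := by
  have key : ∀ x ∈ Submodule.span k (Set.range (glTensorRep σ k d)), φ ∘ₗ x = x ∘ₗ φ := by
    intro x hx
    induction hx using Submodule.span_induction with
    | mem h hh =>
      obtain ⟨g, rfl⟩ := hh
      exact hφ g
    | zero => rw [LinearMap.comp_zero, LinearMap.zero_comp]
    | add h h' _ _ ih ih' => rw [LinearMap.comp_add, LinearMap.add_comp, ih, ih']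
    | smul r h _ ih => rw [LinearMap.comp_smul, LinearMap.smul_comp, ih]
  exact key ψ (mem_span_glTensorRep_of_comm ψ hψ)

/-- **THE MULTILINEAR FIRST FUNDAMENTAL THEOREM FOR `GL(V)` (Schur's double commutant; Fulton–Harris Thm. 6.3 (2))**: over a field of characteristic `0`,
an endomorphism of `(k^σ)^{⊗d}` commuting with every `g^{⊗d}`, `g ∈ GL σ k`, is a `k`-linear combination of the permutations of the factors:
`End_{GL(V)}(V^{⊗d}) = span_k {permTensorRep τ : τ ∈ 𝔖_d}`.  Proof: `φ` commutes with the whole `𝔖_d`-commutant (`comp_eq_comp_of_comm_permTensorRep`),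
i.e. is linear over `End_{k[𝔖_d]}((k^σ)^{⊗d})`; `(k^σ)^{⊗d}` is a semisimple `k[𝔖_d]`-module (Maschke), so by the Jacobson density theorem (Mathlib
`jacobson_density`) `φ` is the action of some `r ∈ k[𝔖_d]` on the finite basis `tensorBasis`, hence everywhere.
[cite: FultonHarrisGTM129, Thm. 6.3 (2), Lemma 6.22 (i)–(ii), Lemma 6.23] -/
theorem mem_span_permTensorRep_of_comm_glTensorRep [CharZero k] (φ : Module.End k (TensorPower k d (σ → k)))
    (hφ : ∀ g : GL σ k, φ ∘ₗ glTensorRep σ k d g = glTensorRep σ k d g ∘ₗ φ) :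
    φ ∈ Submodule.span k (Set.range (permTensorRep k (σ → k) d)) := by
  classical
  set ρ := permTensorRep k (σ → k) d with hρ
  set E := ρ.asModuleEquiv with hE
  -- (2) `φ`, transported to the `k[𝔖_d]`-module `ρ.asModule`, is linear over the commutant `End_{k[𝔖_d]}(ρ.asModule)`
  let f : Module.End (Module.End (MonoidAlgebra k (Equiv.Perm (Fin d))) ρ.asModule) ρ.asModule :=
    { toFun := fun m => E.symm (φ (E m))
      map_add' := fun m m' => by simp only [map_add]
      map_smul' := fun δ m => by
        -- `ψ := E ∘ δ ∘ E⁻¹` is `𝔖_d`-equivariant, so `φ` commutes with it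
        have hψ : ∀ τ : Equiv.Perm (Fin d),
            (E.toLinearMap ∘ₗ δ.restrictScalars k ∘ₗ E.symm.toLinearMap) ∘ₗ ρ τ =
              ρ τ ∘ₗ (E.toLinearMap ∘ₗ δ.restrictScalars k ∘ₗ E.symm.toLinearMap) := by
          intro τ
          refine LinearMap.ext fun v => ?_
          simp only [LinearMap.comp_apply, LinearEquiv.coe_coe, LinearMap.restrictScalars_apply]
          rw [Representation.asModuleEquiv_symm_map_rho, map_smul, Representation.asModuleEquiv_map_smul,
            Representation.asAlgebraHom_of]
        have hc := congrArg (fun T : Module.End k (TensorPower k d (σ → k)) => T (E m))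
          (comp_eq_comp_of_comm_permTensorRep φ hφ _ hψ)
        simp only [LinearMap.comp_apply, LinearEquiv.coe_coe, LinearMap.restrictScalars_apply, LinearEquiv.symm_apply_apply] at hc
        rw [RingHom.id_apply, Module.End.smul_def, Module.End.smul_def, hc, LinearEquiv.symm_apply_apply] }
  -- (3) Jacobson density on the basis `E⁻¹(tensorBasis)` (Maschke: `ρ.asModule` is a semisimple `k[𝔖_d]`-module)
  obtain ⟨r, hr⟩ := jacobson_density f (Finset.univ.image fun i : Fin d → σ => E.symm (tensorBasis k σ d i))
  -- `φ = ρ(r)` on the basis, hence everywhere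
  have key : φ = ρ.asAlgebraHom r := by
    refine (tensorBasis k σ d).ext fun i => ?_
    have h1 : E.symm (φ (E (E.symm (tensorBasis k σ d i)))) = r • E.symm (tensorBasis k σ d i) :=
      hr _ (Finset.mem_image_of_mem _ (Finset.mem_univ i))
    rw [LinearEquiv.apply_symm_apply] at h1
    have h2 := congrArg E h1
    rw [LinearEquiv.apply_symm_apply, Representation.asModuleEquiv_map_smul, LinearEquiv.apply_symm_apply] at h2
    exact h2
  -- (4) `ρ(r) = Σ_τ r(τ) • permTensorRep τ` lies in the span
  rw [key, Representation.asAlgebraHom_def, MonoidAlgebra.lift_apply]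
  refine Submodule.sum_mem _ fun τ _ => Submodule.smul_mem _ _ (Submodule.subset_span ⟨τ, rfl⟩)

/-- **`End_{GL(V)}(V^{⊗d}) = span_k 𝔖_d`, as an `iff`** (the converse: the two actions commute, ★ `permTensorRep_comp_glTensorRep`, FH §6.1).
[cite: FultonHarrisGTM129, Thm. 6.3 (2), §6.1] -/
theorem mem_span_permTensorRep_iff_comm_glTensorRep [CharZero k] (φ : Module.End k (TensorPower k d (σ → k))) :
    φ ∈ Submodule.span k (Set.range (permTensorRep k (σ → k) d)) ↔
      ∀ g : GL σ k, φ ∘ₗ glTensorRep σ k d g = glTensorRep σ k d g ∘ₗ φ := by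
  refine ⟨fun hφ g => ?_, mem_span_permTensorRep_of_comm_glTensorRep φ⟩
  induction hφ using Submodule.span_induction with
  | mem h hh =>
    obtain ⟨τ, rfl⟩ := hh
    exact permTensorRep_comp_glTensorRep σ k d τ g
  | zero => rw [LinearMap.comp_zero, LinearMap.zero_comp]
  | add h h' _ _ ih ih' => rw [LinearMap.comp_add, LinearMap.add_comp, ih, ih']
  | smul r h _ ih => rw [LinearMap.comp_smul, LinearMap.smul_comp, ih]

end Summit.HodgeConjecture.HodgeConjecture.Cruxes.HLiu418.K2LiuTensorPowerDoubleCommutant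

end
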